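import Mathlib
import Literature.NumberTheory.Automorphic.HilbertModularFormQExpansion
import Summits.Langlands.Langlands.Theorems.CapacityClassicalityHilbertIntegralOverconvergentIsCongruenceEngineInstanceData
import Summits.Langlands.Langlands.Theorems.CapacityClassicalityHilbertIntegralOverconvergentIsCongruenceStubMvWeightedNormMultisetProd

/-!
# Hilbert classicality modulo the named facts, part 2: archimedean sizes of the unknown and of the auxiliary families
# (line `Sketch-ideate-r1-k1`, § T, crux stmt-Langlands-8485)

`hcm_archBounds` — the hypothesis `harch` of the abstract engine `stub_abstractEngineMain` for the Hilbert instance: for every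
`η > 0` ONE constant `B ≥ 1` bounds, under every complex embedding `τ'` of `E`, the weighted `ℓ¹` size
`∑_n ‖τ'(X_n)‖ e^{-η |n|}` of the integral encoded `q`-expansion `g` of the unknown, and `B^D` bounds the size of every auxiliary
series `(∏_{l ∈ s} AZ_l) · AG^j` (`#s = D - j`), where `AZ_l`, `AG` are the integral encodings of the supplied forms: each factor
converges on the whole tube under every embedding (`archFromTube`), and sizes are submultiplicative
(`stub_mvWeightedNorm_multisetProd`).
-/

set_option linter.dupNamespace false

noncomputable section

namespace Summit.Langlands.Langlands.Theorems.HilbertIntegralOverconvergentIsCongruence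

open MeasureTheory Complex NumberField
open Literature.NumberTheory.Automorphic Literature.NumberTheory.Automorphic.HilbertModular
open scoped MatrixGroups NumberField

/-- **Archimedean sizes for the engine instance** (`harch` of `stub_abstractEngineMain`): see the module docstring.  The series
`AZ l`, `AG`, `g` over `𝓞 E` are given through their `E`-coefficients on the encoded cone (`qg l ν`, `qG ν`, `c ν`) and `0` off
it; the functions `qg l`, `qG`, `c` have `q`-series converging absolutely on the tube under every complex embedding. [folklore] -/
theorem hcm_archBounds (F : Type) [Field F] [NumberField F] [NumberField.IsTotallyReal F] (d : ℕ) (idx : F → (Fin d →₀ ℕ))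
    (α : F) (hα : ∀ σ : F →+* ℝ, 0 < σ α) (hinj : Set.InjOn idx (qIndexSet F))
    (htrace : ∀ ν ∈ qIndexSet F, ((∑ j, idx ν j : ℕ) : ℚ) = Algebra.trace ℚ F (α * ν))
    (E : Type) [Field E] [NumberField E] (wt : (Fin d →₀ ℕ) →+ ℕ) (hwt : ∀ n, wt n = ∑ j, n j)
    {ιg : Type} [Fintype ιg] (qg : ιg → F → E) (qG c : F → E)
    (hqg_arch : ∀ l (τ' : E →+* ℂ) (y : (F →+* ℝ) → ℝ), (∀ σ, 0 < y σ) →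
      Summable (fun ν : {ν : F | ∀ b : 𝓞 F, ∃ n : ℤ, Algebra.trace ℚ F (ν * b) = n} ↦
        ‖τ' (qg l ν)‖ * Real.exp (-(2 * Real.pi * ∑ σ : F →+* ℝ, σ (ν : F) * y σ))))
    (hqG_arch : ∀ (τ' : E →+* ℂ) (y : (F →+* ℝ) → ℝ), (∀ σ, 0 < y σ) →
      Summable (fun ν : {ν : F | ∀ b : 𝓞 F, ∃ n : ℤ, Algebra.trace ℚ F (ν * b) = n} ↦
        ‖τ' (qG ν)‖ * Real.exp (-(2 * Real.pi * ∑ σ : F →+* ℝ, σ (ν : F) * y σ))))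
    (harch_c : ∀ (τ' : E →+* ℂ) (y : (F →+* ℝ) → ℝ), (∀ σ, 0 < y σ) →
      Summable (fun ν : {ν : F | ∀ b : 𝓞 F, ∃ n : ℤ, Algebra.trace ℚ F (ν * b) = n} ↦
        ‖τ' (c ν)‖ * Real.exp (-(2 * Real.pi * ∑ σ : F →+* ℝ, σ (ν : F) * y σ))))
    (AZ : ιg → MvPowerSeries (Fin d) (𝓞 E)) (AG g : MvPowerSeries (Fin d) (𝓞 E))
    (hAZc : ∀ l, ∀ ν ∈ qIndexSet F,
      MvPowerSeries.coeff (idx ν) (MvPowerSeries.map (algebraMap (𝓞 E) E) (AZ l)) = qg l ν)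
    (hAZo : ∀ l n, (∀ ν ∈ qIndexSet F, idx ν ≠ n) → MvPowerSeries.coeff n (MvPowerSeries.map (algebraMap (𝓞 E) E) (AZ l)) = 0)
    (hAGc : ∀ ν ∈ qIndexSet F, MvPowerSeries.coeff (idx ν) (MvPowerSeries.map (algebraMap (𝓞 E) E) AG) = qG ν)
    (hAGo : ∀ n, (∀ ν ∈ qIndexSet F, idx ν ≠ n) → MvPowerSeries.coeff n (MvPowerSeries.map (algebraMap (𝓞 E) E) AG) = 0)
    (hgc : ∀ ν ∈ qIndexSet F, MvPowerSeries.coeff (idx ν) (MvPowerSeries.map (algebraMap (𝓞 E) E) g) = c ν)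
    (hgo : ∀ n, (∀ ν ∈ qIndexSet F, idx ν ≠ n) → MvPowerSeries.coeff n (MvPowerSeries.map (algebraMap (𝓞 E) E) g) = 0)
    (η : ℝ) (hη : 0 < η) :
    ∃ B : ℝ, 1 ≤ B ∧
      (∀ τ' : E →+* ℂ,
        Summable (fun n : Fin d →₀ ℕ ↦ ‖τ' (algebraMap (𝓞 E) E (MvPowerSeries.coeff n g))‖ * Real.exp (-η) ^ wt n) ∧
        ∑' n : Fin d →₀ ℕ, ‖τ' (algebraMap (𝓞 E) E (MvPowerSeries.coeff n g))‖ * Real.exp (-η) ^ wt n ≤ B) ∧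
      ∀ (D j : ℕ) (s : Multiset ιg), Multiset.card s = D - j → j < D → ∀ τ' : E →+* ℂ,
        Summable (fun n : Fin d →₀ ℕ ↦ ‖τ' (algebraMap (𝓞 E) E (MvPowerSeries.coeff n
          ((s.map AZ).prod * AG ^ j)))‖ * Real.exp (-η) ^ wt n) ∧
        ∑' n : Fin d →₀ ℕ, ‖τ' (algebraMap (𝓞 E) E (MvPowerSeries.coeff n
          ((s.map AZ).prod * AG ^ j)))‖ * Real.exp (-η) ^ wt n ≤ B ^ D := by
  classical
  obtain ⟨Bg, hBg1, hBg⟩ := archFromTube F d idx α hα hinj htrace E c harch_c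
    (MvPowerSeries.map (algebraMap (𝓞 E) E) g) hgc hgo η hη
  choose Bl hBl1 hBl using fun l ↦ archFromTube F d idx α hα hinj htrace E (qg l) (hqg_arch l)
    (MvPowerSeries.map (algebraMap (𝓞 E) E) (AZ l)) (hAZc l) (hAZo l) η hη
  obtain ⟨BG, hBG1, hBG⟩ := archFromTube F d idx α hα hinj htrace E qG hqG_arch
    (MvPowerSeries.map (algebraMap (𝓞 E) E) AG) hAGc hAGo η hη
  set B : ℝ := Bg + (∑ l, Bl l) + BG with hBdef
  have hBl0 : ∀ l, 0 ≤ Bl l := fun l ↦ zero_le_one.trans (hBl1 l)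
  have hsumBl : 0 ≤ ∑ l, Bl l := Finset.sum_nonneg fun l _ ↦ hBl0 l
  have hBg0 : 0 ≤ Bg := zero_le_one.trans hBg1
  have hBG0 : 0 ≤ BG := zero_le_one.trans hBG1
  have hBgB : Bg ≤ B := by rw [hBdef]; linarith
  have hBlB : ∀ l, Bl l ≤ B := fun l ↦ by
    have : Bl l ≤ ∑ l', Bl l' := Finset.single_le_sum (fun l' _ ↦ hBl0 l') (Finset.mem_univ l)
    rw [hBdef]; linarith
  have hBGB : BG ≤ B := by rw [hBdef]; linarith
  have hB1 : 1 ≤ B := hBg1.trans hBgB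
  have ht0 : 0 ≤ Real.exp (-η) := (Real.exp_pos _).le
  have key : ∀ (X : MvPowerSeries (Fin d) (𝓞 E)) (τ' : E →+* ℂ) (n : Fin d →₀ ℕ),
      ‖τ' (algebraMap (𝓞 E) E (MvPowerSeries.coeff n X))‖ * Real.exp (-η) ^ wt n =
      ‖MvPowerSeries.coeff n (MvPowerSeries.map (τ'.comp (algebraMap (𝓞 E) E)) X)‖ * Real.exp (-η) ^ wt n := by
    intro X τ' n
    rw [MvPowerSeries.coeff_map, RingHom.comp_apply]
  refine ⟨B, hB1, fun τ' ↦ ?_, fun D j s hs hj τ' ↦ ?_⟩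
  · have h := hBg τ'
    simp only [MvPowerSeries.coeff_map, hwt] at h ⊢
    exact ⟨h.1, h.2.trans hBgB⟩
  set ms : Multiset (MvPowerSeries (Fin d) ℂ) :=
    (s.map (fun l ↦ MvPowerSeries.map (τ'.comp (algebraMap (𝓞 E) E)) (AZ l))) +
      Multiset.replicate j (MvPowerSeries.map (τ'.comp (algebraMap (𝓞 E) E)) AG) with hms
  have hprod : MvPowerSeries.map (τ'.comp (algebraMap (𝓞 E) E)) ((s.map AZ).prod * AG ^ j) = ms.prod := by
    rw [hms, Multiset.prod_add, Multiset.prod_replicate, map_mul, map_pow, map_multiset_prod, Multiset.map_map]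
    rfl
  have hcard : Multiset.card ms = D := by
    rw [hms, Multiset.card_add, Multiset.card_map, Multiset.card_replicate, hs]
    omega
  have hmem : ∀ φ ∈ ms, Summable (fun n : Fin d →₀ ℕ ↦ ‖MvPowerSeries.coeff n φ‖ * Real.exp (-η) ^ wt n) ∧
      ∑' n : Fin d →₀ ℕ, ‖MvPowerSeries.coeff n φ‖ * Real.exp (-η) ^ wt n ≤ B := by
    intro φ hφ
    rw [hms, Multiset.mem_add] at hφ
    rcases hφ with hφ | hφ
    · obtain ⟨l, -, rfl⟩ := Multiset.mem_map.1 hφ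
      have h := hBl l τ'
      simp only [MvPowerSeries.coeff_map, RingHom.comp_apply, hwt] at h ⊢
      exact ⟨h.1, h.2.trans (hBlB l)⟩
    · rw [Multiset.eq_of_mem_replicate hφ]
      have h := hBG τ'
      simp only [MvPowerSeries.coeff_map, RingHom.comp_apply, hwt] at h ⊢
      exact ⟨h.1, h.2.trans hBGB⟩
  obtain ⟨hsum, hle⟩ := stub_mvWeightedNorm_multisetProd wt (Real.exp (-η)) ht0 B hB1 ms hmem
  rw [hcard] at hle
  simp only [key]
  rw [hprod]
  exact ⟨hsum, hle⟩

end Summit.Langlands.Langlands.Theorems.HilbertIntegralOverconvergentIsCongruence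

end
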